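import Literature.Topology.FourManifolds.SmoothEmbeddingCriteria
import Literature.Geometry.Manifold.SmoothEmbeddingInverse
import HarnessLib

/-!
# Smooth embeddings with open range from a smooth left inverse

General differential topology (topic `Geometry/Manifold`; everything PROVED, no definitions).
Mathlib's `Manifold.IsSmoothEmbedding` asks for immersion charts; for maps between manifolds
over boundaryless models with identified model vector spaces, the tree's criterion
`Literature.Topology.FourManifolds.isSmoothEmbedding_of_openPartialHomeomorph`
(`SmoothEmbeddingCriteria.lean`, Lee 2013, Prop. 5.2) reduces this to an open partial
homeomorphism with smooth inverse. This file packages the form in which that criterion is used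
over and over for tubes, caps and pieces of a surgically modified Ricci flow
(`ProperFunctionTube.lean`, `TubeUntwist.lean`, `CappedTube.lean`): **a smooth, injective, open
map with a left inverse smooth on its range is a smooth embedding with open range**
(`isSmoothEmbedding_of_leftInverse_of_isOpenMap`), together with the two reparametrisation
instances needed downstream — precomposition of a smooth open embedding with a homeomorphism
that is smooth with smooth inverse (`isSmoothEmbedding_comp_of_inverse`).

## References

* J. M. Lee, *Introduction to Smooth Manifolds*, 2nd ed., GTM 218 (2013), Prop. 4.22, Prop. 5.2.
  [LeeSmoothManifolds2013]
-/

open scoped Manifold ContDiff Topology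
open Set Function Topology

noncomputable section

namespace Literature.Geometry.Manifold

universe u

variable {E : Type u} [NormedAddCommGroup E] [NormedSpace ℝ E]
  {H : Type*} [TopologicalSpace H] {I : ModelWithCorners ℝ E H} [I.Boundaryless]
  {M : Type*} [TopologicalSpace M] [ChartedSpace H M] [IsManifold I ∞ M]
  {EY : Type*} [NormedAddCommGroup EY] [NormedSpace ℝ EY] {HY : Type*} [TopologicalSpace HY]
  {IY : ModelWithCorners ℝ EY HY} [IY.Boundaryless]
  {Y : Type*} [TopologicalSpace Y] [ChartedSpace HY Y] [IsManifold IY ∞ Y]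

/-- **A smooth injective open map with a smooth left inverse on its range is a smooth embedding**
(with open range): it is an open topological embedding, the associated open partial
homeomorphism has source `univ` and its inverse agrees on the range with the given left inverse,
so `isSmoothEmbedding_of_openPartialHomeomorph` applies (boundaryless models, model vector
spaces identified by `L`). Lee (2013), Prop. 4.22 and Prop. 5.2. [cite: LeeSmoothManifolds2013, Prop. 5.2] -/
theorem isSmoothEmbedding_of_leftInverse_of_isOpenMap {f : Y → M} (hf : ContMDiff IY I ∞ f)
    (hinj : Injective f) (hopen : IsOpenMap f) {finv : M → Y}
    (hfinv : ContMDiffOn I IY ∞ finv (range f)) (hleft : ∀ y, finv (f y) = y) (L : EY ≃L[ℝ] E) :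
    Manifold.IsSmoothEmbedding IY I ∞ f ∧ IsOpen (range f) := by
  have hoe : IsOpenEmbedding f :=
    IsOpenEmbedding.of_continuous_injective_isOpenMap hf.continuous hinj hopen
  refine ⟨?_, hoe.isOpen_range⟩
  rcases isEmpty_or_nonempty Y with hY | hY
  · exact ⟨Manifold.IsImmersionOfComplement.isImmersion (F := Unit) fun x ↦ isEmptyElim x,
      hoe.isEmbedding⟩
  set P := hoe.toOpenPartialHomeomorph f with hP
  have hPsymm : ContMDiffOn I IY ∞ P.symm P.target := by
    rw [hoe.toOpenPartialHomeomorph_target]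
    refine hfinv.congr ?_
    rintro _ ⟨y, rfl⟩
    rw [hoe.toOpenPartialHomeomorph_left_inv, hleft]
  exact Literature.Topology.FourManifolds.isSmoothEmbedding_of_openPartialHomeomorph P
    (hoe.toOpenPartialHomeomorph_source f)
    (by rw [hoe.toOpenPartialHomeomorph_source]; exact hf.contMDiffOn) hPsymm L

omit [I.Boundaryless] [IsManifold I ∞ M] [IY.Boundaryless] [IsManifold IY ∞ Y] in
/-- A smooth embedding with open range is an open map. [folklore] -/
theorem isOpenMap_of_isSmoothEmbedding_of_isOpen_range {f : Y → M}
    (hf : Manifold.IsSmoothEmbedding IY I ∞ f) (ho : IsOpen (range f)) : IsOpenMap f :=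
  (⟨hf.isEmbedding, ho⟩ : IsOpenEmbedding f).isOpenMap

omit [IY.Boundaryless] [IsManifold IY ∞ Y] in
/-- **Reparametrising a smooth open embedding.** Let `f : Y ↪ M` be a smooth embedding with open
range and `φ : Z → Y` a smooth injective open map with a left inverse `φinv` smooth on `range φ`
(e.g. a diffeomorphism onto an open subset of `Y`). Then `f ∘ φ` is a smooth embedding with open
range `f(range φ)`. [cite: LeeSmoothManifolds2013, Prop. 5.2] -/
theorem isSmoothEmbedding_comp_of_inverse {EZ : Type*} [NormedAddCommGroup EZ] [NormedSpace ℝ EZ]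
    {HZ : Type*} [TopologicalSpace HZ] {IZ : ModelWithCorners ℝ EZ HZ} [IZ.Boundaryless]
    {Z : Type*} [TopologicalSpace Z] [ChartedSpace HZ Z] [IsManifold IZ ∞ Z] [Nonempty Y]
    {f : Y → M} (hf : Manifold.IsSmoothEmbedding IY I ∞ f) (ho : IsOpen (range f))
    {φ : Z → Y} (hφ : ContMDiff IZ IY ∞ φ) (hφinj : Injective φ) (hφo : IsOpenMap φ)
    {φinv : Y → Z} (hφinv : ContMDiffOn IY IZ ∞ φinv (range φ)) (hφleft : ∀ z, φinv (φ z) = z)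
    (L : EZ ≃L[ℝ] E) :
    Manifold.IsSmoothEmbedding IZ I ∞ (f ∘ φ) ∧ IsOpen (range (f ∘ φ)) ∧
      range (f ∘ φ) = f '' range φ := by
  have hrange : range (f ∘ φ) = f '' range φ := range_comp f φ
  have hfinv : ContMDiffOn I IY ∞ (invFun f) (range f) := contMDiffOn_invFun_range hf
  obtain ⟨h1, h2⟩ := isSmoothEmbedding_of_leftInverse_of_isOpenMap (hf.contMDiff.comp hφ)
    (hf.isEmbedding.injective.comp hφinj)
    ((isOpenMap_of_isSmoothEmbedding_of_isOpen_range hf ho).comp hφo)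
    (finv := φinv ∘ invFun f) (by
      refine hφinv.comp (hfinv.mono ?_) ?_
      · rw [hrange]; exact image_subset_range _ _
      · rintro _ ⟨z, rfl⟩
        show invFun f (f (φ z)) ∈ range φ
        rw [leftInverse_invFun hf.isEmbedding.injective]
        exact mem_range_self z)
    (fun z ↦ by
      show φinv (invFun f (f (φ z))) = z
      rw [leftInverse_invFun hf.isEmbedding.injective, hφleft]) L
  exact ⟨h1, h2, hrange⟩

end Literature.Geometry.Manifold

end
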